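import Mathlib
import HarnessLib
import Summits.Ventures.LatticeQCDFlow.Scaling.AutoregressiveGaugeHeatBathAnyDim
import Summits.Ventures.LatticeQCDFlow.Scaling.BoxRankedMorseCount

/-!
# LatticeQCDFlow / Scaling — FREE BOUNDARY at the sampler level: the exact heat-bath autoregression on the
# Morse plaquettes of a box, proposed to a Metropolis step for the box weight, is accepted with
# probability `≥ (m/M)^{#(K ∖ Morse)}` — `(m/M)^{(R−1)³}` in three dimensions, `1` in two

HONEST FRAMING: exact (Metropolis-corrected) sampling algorithms for lattice gauge theory;
figures of merit are autocorrelation/cost numbers at stated couplings and volumes; no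
continuum-physics claim.

Venture `LatticeQCDFlow` (cell pub-lqcd), topic `Scaling`, FANOUT row 30 (lean-1, GEN-25) — OUR WORK on
THEORY-2.md §4 row C5.  `BoxRankedMorseBound` ∕ `BoxRankedMorseCount`: inside the box `K` of side `R` of
`(ℤ/L)^d` (`R + 1 ≤ L`) the largest ranked structure is `Morse ∩ K`, leaving `#(K ∖ Morse)` box plaquettes
outside (`(R−1)³` in `d = 3`, `0` in `d = 2`).  This file is the sampler statement for the FREE-BOUNDARY
WEIGHT `F_K(U) = ∏_{p ∈ K} w(U_p)` (links outside the box free), `w` continuous with `0 < m ≤ w ≤ M`: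

* §1 **`subBlockProposal_imhAcceptQ_ge`** — for ANY `B ⊆ K` and `Z > 0` the independence proposal of
  density `F_B/Z` is accepted against `F_K` with probability `min(1, F_{K∖B}(V)/F_{K∖B}(U)) ≥ (m/M)^{#(K∖B)}`
  (the general form of `Scaling/AutoregressiveGaugeHeatBathAnyDim.plaquetteBlockProposal_imhAcceptQ_ge`,
  which is `K = univ`);
* §1b **`subBlockProposal_autocorrelation`** — the Doeblin law for the block target: with
  `π = (F_K/Z_K)·Haar^{⊗E}`, `q = (F_B/Z_B)·Haar^{⊗E}`, `B ⊆ K`, `k = #(K∖B)`, the exact independence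
  Metropolis kernel has `|C_f(t)| ≤ (1 − (m/M)^k)^t ∫f² dπ` and `τ_int(f) ≤ (M/m)^k − 1/2` for every bounded
  measurable centred `f` (the general form of `plaquetteBlockProposal_autocorrelation`); **`box_autocorrelation_three`**
  — `d = 3`, `B = Morse ∩ K`: `τ_int ≤ (M/m)^{(R−1)³} − 1/2`;
* §2 **`boxMorse_imhAcceptQ_ge`** — the exact heat-bath hybrid of the Morse structure cut to the box
  (`Scaling/AutoregressiveGaugeHeatBathRanked.ranked_arHybrid_eq_target`) proposed to the Metropolis step
  for `F_K` is accepted with probability `≥ (m/M)^{#(K ∖ Morse)}` from EVERY state, for every duplicate-free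
  list of all links; **`boxMorse_imhAcceptQ_ge_three`** — `d = 3`: `≥ (m/M)^{(R−1)³}`, one factor `m/M`
  per unit cube; **`boxMorse_imhAcceptQ_eq_one_two`** — `d = 2`: acceptance `1` (the free-boundary
  exactness of `AutoregressiveGaugeHeatBathExact2D`, now for the box inside the torus lattice type).

No `def`, no `sorry`, nothing cited as a fact beyond the tree.
-/

noncomputable section

namespace Summit.Ventures.LatticeQCDFlow.Theory2.Autoregressive

open MeasureTheory Finset
open Literature.MathematicalPhysics.QuantumFieldTheory Literature.MathematicalPhysics.QuantumLattice
open Summit.Ventures.LatticeQCDFlow.Exactness Summit.Ventures.LatticeQCDFlow.Scoring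

variable {d L R : ℕ} [NeZero L] {G : Type*} [Group G] [TopologicalSpace G] [IsTopologicalGroup G]
  [CompactSpace G] [SecondCountableTopology G] [MeasurableSpace G] [BorelSpace G]

/-! ## §1 Acceptance of a sub-block proposal against a block weight -/

omit [NeZero L] [TopologicalSpace G] [IsTopologicalGroup G] [CompactSpace G] [SecondCountableTopology G]
  [MeasurableSpace G] [BorelSpace G] in
/-- **Acceptance `≥ (m/M)^{#(K ∖ B)}` for every state and proposal.**  `0 < m ≤ w ≤ M`, `B ⊆ K`, any
`Z > 0`: the Metropolis–Hastings acceptance of the independence proposal with density `F_B/Z` against the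
block weight `F_K = ∏_{p ∈ K} w(U_p)` is `min(1, F_{K∖B}(V)/F_{K∖B}(U)) ≥ (m/M)^{#(K∖B)}`. [ours] -/
theorem subBlockProposal_imhAcceptQ_ge {w : G → ℝ} {m M : ℝ} (hm0 : 0 < m)
    (hm : ∀ g, m ≤ w g) (hM : ∀ g, w g ≤ M) {B K : Finset (Plaquette d L)} (hBK : B ⊆ K) {Z : ℝ}
    (hZ : 0 < Z) (U V : GaugeConfig d L G) :
    (m / M) ^ (K \ B).card ≤
      imhAcceptQ (fun U : GaugeConfig d L G => ∏ p ∈ K, w (plaquetteHolonomy U p.1 p.2.1.1 p.2.1.2))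
        (fun U : GaugeConfig d L G => (∏ p ∈ B, w (plaquetteHolonomy U p.1 p.2.1.1 p.2.1.2)) / Z) U V := by
  have hw0 : ∀ g, 0 < w g := fun g => hm0.trans_le (hm g)
  have hMpos : 0 < M := (hw0 1).trans_le (hM 1)
  set FB : GaugeConfig d L G → ℝ := fun U => ∏ p ∈ B, w (plaquetteHolonomy U p.1 p.2.1.1 p.2.1.2) with hFB
  set FR : GaugeConfig d L G → ℝ := fun U => ∏ p ∈ K \ B, w (plaquetteHolonomy U p.1 p.2.1.1 p.2.1.2)
    with hFR
  have hsplit : ∀ U, (∏ p ∈ K, w (plaquetteHolonomy U p.1 p.2.1.1 p.2.1.2)) = FR U * FB U :=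
    fun U => (Finset.prod_sdiff hBK).symm
  have hFBpos : ∀ U, 0 < FB U := fun U => prod_pos fun p _ => hw0 _
  have hFRpos : ∀ U, 0 < FR U := fun U => prod_pos fun p _ => hw0 _
  have hFRge : ∀ U, m ^ (K \ B).card ≤ FR U := fun U =>
    (pow_le_prodPlaquetteWeight_le_pow_anyDim hm0 hm hM _ U).1
  have hFRle : ∀ U, FR U ≤ M ^ (K \ B).card := fun U =>
    (pow_le_prodPlaquetteWeight_le_pow_anyDim hm0 hm hM _ U).2
  unfold imhAcceptQ
  beta_reduce
  rw [hsplit U, hsplit V]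
  have hratio : FR V * FB V * (FB U / Z) / (FR U * FB U * (FB V / Z)) = FR V / FR U := by
    field_simp [(hFBpos U).ne', (hFBpos V).ne', (hFRpos U).ne', hZ.ne']
  rw [hratio]
  refine le_min ?_ ?_
  · rw [div_pow]
    exact div_le_one_of_le₀ (pow_le_pow_left₀ hm0.le (by
      have := hm 1; have := hM 1; linarith) _) (pow_nonneg hMpos.le _)
  · rw [div_pow, div_le_div_iff₀ (pow_pos hMpos _) (hFRpos U)]
    calc m ^ (K \ B).card * FR U ≤ m ^ (K \ B).card * M ^ (K \ B).card :=
          mul_le_mul_of_nonneg_left (hFRle U) (pow_nonneg hm0.le _)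
      _ = M ^ (K \ B).card * m ^ (K \ B).card := mul_comm _ _
      _ ≤ FR V * M ^ (K \ B).card := by
          rw [mul_comm (FR V)]
          exact mul_le_mul_of_nonneg_left (hFRge V) (pow_nonneg hMpos.le _)

/-! ## §1b The Doeblin law for a block target -/

/-- **The sub-block–proposal exact sampler for a block target: `τ_int ≤ (M/m)^k − 1/2`, `k = #(K ∖ B)`.**
`w` continuous with `0 < m ≤ w ≤ M`; `B ⊆ K` finsets of plaquettes of `(ℤ/L)^d`; `F_K = ∏_{p∈K} w(U_p)`
the block (free-boundary) weight, `F_B` the proposal weight; `π = (F_K/Z_K)·Haar^{⊗E}`,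
`q = (F_B/Z_B)·Haar^{⊗E}`.  Then `q = ρ·π` with `ρ = Z_K/(Z_B·F_{K∖B})`, `ρ(U) ≤ (M/m)^k ρ(V)`, and for the
exact independence Metropolis kernel every bounded measurable `π`-centred `f` has
`|C_f(t)| ≤ (1 − (m/M)^k)^t ∫ f² dπ` and `τ_int(f) ≤ (M/m)^k − 1/2`. [ours] -/
theorem subBlockProposal_autocorrelation {w : G → ℝ} (hw : Continuous w) {m M : ℝ} (hm0 : 0 < m)
    (hm : ∀ g, m ≤ w g) (hM : ∀ g, w g ≤ M) {B K : Finset (Plaquette d L)} (hBK : B ⊆ K)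
    (π q : Measure (GaugeConfig d L G)) [IsProbabilityMeasure π] [IsProbabilityMeasure q]
    (hπ : π = (Measure.pi fun _ : Edge d L => haarProbability G).withDensity fun U =>
      ENNReal.ofReal ((∏ p ∈ K, w (plaquetteHolonomy U p.1 p.2.1.1 p.2.1.2)) /
        ∫ V, ∏ p ∈ K, w (plaquetteHolonomy V p.1 p.2.1.1 p.2.1.2)
          ∂(Measure.pi fun _ : Edge d L => haarProbability G)))
    (hq : q = (Measure.pi fun _ : Edge d L => haarProbability G).withDensity fun U =>
      ENNReal.ofReal ((∏ p ∈ B, w (plaquetteHolonomy U p.1 p.2.1.1 p.2.1.2)) /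
        ∫ V, ∏ p ∈ B, w (plaquetteHolonomy V p.1 p.2.1.1 p.2.1.2)
          ∂(Measure.pi fun _ : Edge d L => haarProbability G)))
    {f : GaugeConfig d L G → ℝ} (hf : Measurable f) {C : ℝ} (hC : ∀ x, |f x| ≤ C)
    (hf0 : ∫ U, f U ∂π = 0) :
    (∀ t : ℕ, |autocov (indepMH q fun U =>
        ((∫ V, ∏ p ∈ K, w (plaquetteHolonomy V p.1 p.2.1.1 p.2.1.2)
            ∂(Measure.pi fun _ : Edge d L => haarProbability G)) /
          ((∫ V, ∏ p ∈ B, w (plaquetteHolonomy V p.1 p.2.1.1 p.2.1.2)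
            ∂(Measure.pi fun _ : Edge d L => haarProbability G)) *
            ∏ p ∈ K \ B, w (plaquetteHolonomy U p.1 p.2.1.1 p.2.1.2)))⁻¹) π f t|
        ≤ (1 - (m / M) ^ (K \ B).card) ^ t * ∫ x, f x ^ 2 ∂π) ∧
      tauInt (fun t => autocov (indepMH q fun U =>
        ((∫ V, ∏ p ∈ K, w (plaquetteHolonomy V p.1 p.2.1.1 p.2.1.2)
            ∂(Measure.pi fun _ : Edge d L => haarProbability G)) /
          ((∫ V, ∏ p ∈ B, w (plaquetteHolonomy V p.1 p.2.1.1 p.2.1.2)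
            ∂(Measure.pi fun _ : Edge d L => haarProbability G)) *
            ∏ p ∈ K \ B, w (plaquetteHolonomy U p.1 p.2.1.1 p.2.1.2)))⁻¹) π f t /
          autocov (indepMH q fun U =>
        ((∫ V, ∏ p ∈ K, w (plaquetteHolonomy V p.1 p.2.1.1 p.2.1.2)
            ∂(Measure.pi fun _ : Edge d L => haarProbability G)) /
          ((∫ V, ∏ p ∈ B, w (plaquetteHolonomy V p.1 p.2.1.1 p.2.1.2)
            ∂(Measure.pi fun _ : Edge d L => haarProbability G)) *
            ∏ p ∈ K \ B, w (plaquetteHolonomy U p.1 p.2.1.1 p.2.1.2)))⁻¹) π f 0) ≤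
        (M / m) ^ (K \ B).card - 1 / 2 := by
  set Haar : Measure (GaugeConfig d L G) := Measure.pi fun _ : Edge d L => haarProbability G with hHaar
  set FT : GaugeConfig d L G → ℝ := fun U => ∏ p ∈ K, w (plaquetteHolonomy U p.1 p.2.1.1 p.2.1.2) with hFT
  set FB : GaugeConfig d L G → ℝ := fun U => ∏ p ∈ B, w (plaquetteHolonomy U p.1 p.2.1.1 p.2.1.2) with hFB
  set FR : GaugeConfig d L G → ℝ := fun U => ∏ p ∈ K \ B, w (plaquetteHolonomy U p.1 p.2.1.1 p.2.1.2)
    with hFR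
  set ZT : ℝ := ∫ V, FT V ∂Haar with hZT
  set ZB : ℝ := ∫ V, FB V ∂Haar with hZB
  set k : ℕ := (K \ B).card with hk
  have hw0 : ∀ g, 0 < w g := fun g => hm0.trans_le (hm g)
  have hMpos : 0 < M := (hw0 1).trans_le (hM 1)
  haveI : IsProbabilityMeasure Haar := by rw [hHaar]; infer_instance
  have hFTc : Continuous FT := continuous_prodPlaquetteWeight_anyDim hw K
  have hFBc : Continuous FB := continuous_prodPlaquetteWeight_anyDim hw B
  have hFRc : Continuous FR := continuous_prodPlaquetteWeight_anyDim hw (K \ B)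
  have hFTpos : ∀ U, 0 < FT U := fun U => prod_pos fun p _ => hw0 _
  have hFBpos : ∀ U, 0 < FB U := fun U => prod_pos fun p _ => hw0 _
  have hFRpos : ∀ U, 0 < FR U := fun U => prod_pos fun p _ => hw0 _
  have hFRge : ∀ U, m ^ k ≤ FR U := fun U => (pow_le_prodPlaquetteWeight_le_pow_anyDim hm0 hm hM _ U).1
  have hFRle : ∀ U, FR U ≤ M ^ k := fun U => (pow_le_prodPlaquetteWeight_le_pow_anyDim hm0 hm hM _ U).2
  have hsplit : ∀ U, FT U = FR U * FB U := fun U => (Finset.prod_sdiff hBK).symm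
  have hint : ∀ {F : GaugeConfig d L G → ℝ}, Continuous F → (∀ U, 0 < F U) → ∀ K : ℝ, (∀ U, F U ≤ K) →
      Integrable F Haar := by
    intro F hF hF0 K hK
    refine Integrable.mono' (integrable_const K) hF.aestronglyMeasurable (ae_of_all _ fun U => ?_)
    rw [Real.norm_eq_abs, abs_of_pos (hF0 U)]; exact hK U
  have hFTi : Integrable FT Haar :=
    hint hFTc hFTpos (M ^ K.card) fun U => (pow_le_prodPlaquetteWeight_le_pow_anyDim hm0 hm hM _ U).2
  have hFBi : Integrable FB Haar :=
    hint hFBc hFBpos (M ^ B.card) fun U => (pow_le_prodPlaquetteWeight_le_pow_anyDim hm0 hm hM _ U).2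
  have hZge : ∀ {F : GaugeConfig d L G → ℝ}, Integrable F Haar → ∀ c : ℝ, (∀ U, c ≤ F U) →
      c ≤ ∫ V, F V ∂Haar := by
    intro F hFi c hc
    have h := integral_mono (integrable_const c) hFi hc
    rwa [integral_const, smul_eq_mul, probReal_univ, one_mul] at h
  have hZTpos : 0 < ZT :=
    lt_of_lt_of_le (pow_pos hm0 _) (hZge hFTi (m ^ K.card)
      fun U => (pow_le_prodPlaquetteWeight_le_pow_anyDim hm0 hm hM _ U).1)
  have hZBpos : 0 < ZB :=
    lt_of_lt_of_le (pow_pos hm0 _) (hZge hFBi (m ^ B.card) fun U => (pow_le_prodPlaquetteWeight_le_pow_anyDim hm0 hm hM _ U).1)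
  -- the density ratio `ρ = Z_K/(Z_B F_R)` : `q = ρ · π`
  set ρ : GaugeConfig d L G → ℝ := fun U => ZT / (ZB * FR U) with hρ
  have hρpos : ∀ U, 0 < ρ U := fun U => div_pos hZTpos (mul_pos hZBpos (hFRpos U))
  have hρm : Measurable ρ := (continuous_const.div (continuous_const.mul hFRc)
    fun U => (mul_pos hZBpos (hFRpos U)).ne').measurable
  have hρq : q = π.withDensity fun U => ENNReal.ofReal (ρ U) := by
    rw [hq, hπ]
    change Haar.withDensity (fun U => ENNReal.ofReal (FB U / ZB)) =
      (Haar.withDensity fun U => ENNReal.ofReal (FT U / ZT)).withDensity fun U => ENNReal.ofReal (ρ U)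
    rw [← withDensity_mul _ (by fun_prop : Measurable fun U => ENNReal.ofReal (FT U / ZT))
      (by exact hρm.ennreal_ofReal)]
    refine withDensity_congr_ae (ae_of_all _ fun U => ?_)
    simp only [Pi.mul_apply]
    rw [← ENNReal.ofReal_mul (div_nonneg (hFTpos U).le hZTpos.le)]
    congr 1
    rw [hρ, hsplit U]
    field_simp [(hFRpos U).ne', hZBpos.ne', hZTpos.ne']
  -- the oscillation bound `ρ U ≤ (M/m)^k ρ V`
  have hmM : 0 < M / m := div_pos hMpos hm0
  have hosc : ∀ U V, ρ U ≤ Real.exp (k * Real.log (M / m)) * ρ V := by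
    intro U V
    rw [Real.exp_nat_mul, Real.exp_log hmM]
    calc ρ U = ZT / (ZB * FR U) := rfl
      _ ≤ ZT / (ZB * m ^ k) :=
          div_le_div_of_nonneg_left hZTpos.le (mul_pos hZBpos (pow_pos hm0 k))
            (mul_le_mul_of_nonneg_left (hFRge U) hZBpos.le)
      _ = (M / m) ^ k * (ZT / (ZB * M ^ k)) := by
          rw [div_pow]; field_simp
      _ ≤ (M / m) ^ k * (ZT / (ZB * FR V)) :=
          mul_le_mul_of_nonneg_left
            (div_le_div_of_nonneg_left hZTpos.le (mul_pos hZBpos (hFRpos V))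
              (mul_le_mul_of_nonneg_left (hFRle V) hZBpos.le)) (pow_nonneg hmM.le k)
      _ = (M / m) ^ k * ρ V := rfl
  have hmain := indepMH_autocorrelation_of_density_ratio (π := π) (q := q) hρm hρpos hρq hosc hf hC hf0
  obtain ⟨hcov, htau, -⟩ := hmain
  have hexp : Real.exp (k * Real.log (M / m)) = (M / m) ^ k := by
    rw [Real.exp_nat_mul, Real.exp_log hmM]
  have hexpneg : Real.exp (-(k * Real.log (M / m))) = (m / M) ^ k := by
    rw [Real.exp_neg, hexp, ← inv_pow, inv_div]
  refine ⟨fun t => ?_, ?_⟩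
  · have h := hcov t
    rwa [hexpneg] at h
  · rwa [hexp] at htau

/-- **THREE DIMENSIONS, FREE BOUNDARY: `τ_int ≤ (M/m)^{(R−1)³} − 1/2`** for the exact independence
Metropolis chain of the box target driven by the Morse box sampler (`1 ≤ R`, `R + 1 ≤ L`; every bounded
measurable centred `f`). [ours] -/
theorem box_autocorrelation_three {w : G → ℝ} (hw : Continuous w) {m M : ℝ} (hm0 : 0 < m)
    (hm : ∀ g, m ≤ w g) (hM : ∀ g, w g ≤ M) (hR : 1 ≤ R) (hRL : R + 1 ≤ L) (K BM : Finset (Plaquette 3 L))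
    (hK : K = Finset.univ.filter (fun p : Plaquette 3 L =>
      (∀ m : Fin 3, (p.1 m).val < R) ∧ (p.1 p.2.1.1).val + 1 < R ∧ (p.1 p.2.1.2).val + 1 < R))
    (hBM : BM = Finset.univ.filter (fun p : Plaquette 3 L =>
      (∀ m : Fin 3, m < p.2.1.1 → p.1 m = 0) ∧
        (p.1 p.2.1.1 ≠ -1 ∨ ((∀ m : Fin 3, p.2.1.1 < m → m < p.2.1.2 → p.1 m = 0) ∧ p.1 p.2.1.2 ≠ -1))))
    (π q : Measure (GaugeConfig 3 L G)) [IsProbabilityMeasure π] [IsProbabilityMeasure q]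
    (hπ : π = (Measure.pi fun _ : Edge 3 L => haarProbability G).withDensity fun U =>
      ENNReal.ofReal ((∏ p ∈ K, w (plaquetteHolonomy U p.1 p.2.1.1 p.2.1.2)) /
        ∫ V, ∏ p ∈ K, w (plaquetteHolonomy V p.1 p.2.1.1 p.2.1.2)
          ∂(Measure.pi fun _ : Edge 3 L => haarProbability G)))
    (hq : q = (Measure.pi fun _ : Edge 3 L => haarProbability G).withDensity fun U =>
      ENNReal.ofReal ((∏ p ∈ BM ∩ K, w (plaquetteHolonomy U p.1 p.2.1.1 p.2.1.2)) /
        ∫ V, ∏ p ∈ BM ∩ K, w (plaquetteHolonomy V p.1 p.2.1.1 p.2.1.2)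
          ∂(Measure.pi fun _ : Edge 3 L => haarProbability G)))
    {f : GaugeConfig 3 L G → ℝ} (hf : Measurable f) {C : ℝ} (hC : ∀ x, |f x| ≤ C)
    (hf0 : ∫ U, f U ∂π = 0) :
    tauInt (fun t => autocov (indepMH q fun U =>
        ((∫ V, ∏ p ∈ K, w (plaquetteHolonomy V p.1 p.2.1.1 p.2.1.2)
            ∂(Measure.pi fun _ : Edge 3 L => haarProbability G)) /
          ((∫ V, ∏ p ∈ BM ∩ K, w (plaquetteHolonomy V p.1 p.2.1.1 p.2.1.2)
            ∂(Measure.pi fun _ : Edge 3 L => haarProbability G)) *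
            ∏ p ∈ K \ (BM ∩ K), w (plaquetteHolonomy U p.1 p.2.1.1 p.2.1.2)))⁻¹) π f t /
          autocov (indepMH q fun U =>
        ((∫ V, ∏ p ∈ K, w (plaquetteHolonomy V p.1 p.2.1.1 p.2.1.2)
            ∂(Measure.pi fun _ : Edge 3 L => haarProbability G)) /
          ((∫ V, ∏ p ∈ BM ∩ K, w (plaquetteHolonomy V p.1 p.2.1.1 p.2.1.2)
            ∂(Measure.pi fun _ : Edge 3 L => haarProbability G)) *
            ∏ p ∈ K \ (BM ∩ K), w (plaquetteHolonomy U p.1 p.2.1.1 p.2.1.2)))⁻¹) π f 0) ≤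
        (M / m) ^ ((R - 1) ^ 3) - 1 / 2 := by
  have hL : 2 ≤ L := by omega
  have hval : (K \ BM).card = (R - 1) ^ 3 :=
    (isLeast_card_compl_ranked_box hL hRL K hK BM hBM).unique
      (isLeast_card_compl_ranked_box_three hR hRL K hK)
  have hKB : (K \ (BM ∩ K)).card = (K \ BM).card := by
    congr 1; ext p; simp only [Finset.mem_sdiff, Finset.mem_inter]; tauto
  have h := (subBlockProposal_autocorrelation (G := G) hw hm0 hm hM (Finset.inter_subset_right (s₁ := BM) (s₂ := K))
    π q hπ hq hf hC hf0).2
  rwa [hKB, hval] at h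

/-! ## §2 The Morse box sampler against the box weight -/

/-- **THE FREE-BOUNDARY SAMPLER: acceptance `≥ (m/M)^{#(K ∖ Morse)}`.**  `L ≥ 2`, `R + 1 ≤ L`; `K` the box,
`BM` the Morse structure, `B = BM ∩ K` (ranked, `BoxRankedMorseBound.morse_inter_box_ranked`); for every
duplicate-free list `l` of all links the heat-bath hybrid `H_l` of the conditioners
`q_b = ∏_{p ∈ B, t p = b} w(U_p)/c` (which IS `F_B/Z_B`, RX) proposed against the box weight
`F_K = ∏_{p ∈ K} w(U_p)` is accepted with probability `≥ (m/M)^{#(K ∖ BM)}` from every state. [ours] -/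
theorem boxMorse_imhAcceptQ_ge (hL : 2 ≤ L) {w : G → ℝ} (hw : Continuous w) {m M : ℝ}
    (hm0 : 0 < m) (hm : ∀ g, m ≤ w g) (hM : ∀ g, w g ≤ M) (K BM : Finset (Plaquette d L))
    (tM : Plaquette d L → Edge d L) (rM : Plaquette d L → ℕ)
    (hBM : BM = Finset.univ.filter (fun p : Plaquette d L =>
      (∀ m : Fin d, m < p.2.1.1 → p.1 m = 0) ∧
        (p.1 p.2.1.1 ≠ -1 ∨ ((∀ m : Fin d, p.2.1.1 < m → m < p.2.1.2 → p.1 m = 0) ∧ p.1 p.2.1.2 ≠ -1))))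
    (htM : tM = fun p => if p.1 p.2.1.1 = -1 then (p.1.shift p.2.1.2, p.2.1.1) else (p.1.shift p.2.1.1, p.2.1.2))
    (hrM : rM = fun p => 4 * ∑ m, (p.1 m).val + (if p.1 p.2.1.1 = -1 then 4 else 3) +
      (if p.1 p.2.1.2 = -1 then 4 else 3))
    (l : List (Edge d L)) (hl : l.Nodup) (hall : ∀ e : Edge d L, e ∈ l) (U V : GaugeConfig d L G) :
    (m / M) ^ (K \ BM).card ≤
      imhAcceptQ (fun U : GaugeConfig d L G => ∏ p ∈ K, w (plaquetteHolonomy U p.1 p.2.1.1 p.2.1.2))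
        (fun U : GaugeConfig d L G => (l.map fun b => ∏ p ∈ (BM ∩ K).filter (fun p' => tM p' = b),
            w (plaquetteHolonomy U p.1 p.2.1.1 p.2.1.2) / (∫ g, w g ∂(haarProbability G))).prod *
          coordAvg (haarProbability G) l.toFinset
            (fun V : GaugeConfig d L G => ∏ p ∈ BM ∩ K, w (plaquetteHolonomy V p.1 p.2.1.1 p.2.1.2)) U /
          (∫ V, ∏ p ∈ BM ∩ K, w (plaquetteHolonomy V p.1 p.2.1.1 p.2.1.2)
            ∂(Measure.pi fun _ : Edge d L => haarProbability G))) U V := by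
  obtain ⟨hsub, ht, hrank⟩ := morse_inter_box_ranked hL K BM tM rM hBM htM hrM
  have hw0 : ∀ g, 0 < w g := fun g => hm0.trans_le (hm g)
  have hc : 0 < ∫ g, w g ∂(haarProbability G) := haarProbability_integral_pos_of_continuous_pos hw hw0
  have hZ : 0 < ∫ V, ∏ p ∈ BM ∩ K, w (plaquetteHolonomy V p.1 p.2.1.1 p.2.1.2)
      ∂(Measure.pi fun _ : Edge d L => haarProbability G) := by
    rw [integral_prod_weight_eq_pow_of_rank (G := G) hL hw hm0 hm hM (BM ∩ K) tM ht rM hrank]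
    exact pow_pos hc _
  have hKB : (K \ (BM ∩ K)).card = (K \ BM).card := by
    congr 1; ext p; simp only [Finset.mem_sdiff, Finset.mem_inter]; tauto
  have h := subBlockProposal_imhAcceptQ_ge (G := G) (L := L) hm0 hm hM hsub hZ U V
  rw [hKB] at h
  unfold imhAcceptQ at h ⊢
  beta_reduce at h ⊢
  rw [ranked_arHybrid_eq_target (G := G) hL hw hm0 hm hM (BM ∩ K) tM ht rM hrank l hl hall U,
    ranked_arHybrid_eq_target (G := G) hL hw hm0 hm hM (BM ∩ K) tM ht rM hrank l hl hall V]
  exact h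

/-- **THREE DIMENSIONS, FREE BOUNDARY: acceptance `≥ (m/M)^{(R−1)³}`** — one factor `m/M` per unit cube
of the box (`1 ≤ R`, `R + 1 ≤ L`). [ours] -/
theorem boxMorse_imhAcceptQ_ge_three {w : G → ℝ} (hw : Continuous w) {m M : ℝ} (hm0 : 0 < m)
    (hm : ∀ g, m ≤ w g) (hM : ∀ g, w g ≤ M) (hR : 1 ≤ R) (hRL : R + 1 ≤ L) (K BM : Finset (Plaquette 3 L))
    (tM : Plaquette 3 L → Edge 3 L) (rM : Plaquette 3 L → ℕ)
    (hK : K = Finset.univ.filter (fun p : Plaquette 3 L =>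
      (∀ m : Fin 3, (p.1 m).val < R) ∧ (p.1 p.2.1.1).val + 1 < R ∧ (p.1 p.2.1.2).val + 1 < R))
    (hBM : BM = Finset.univ.filter (fun p : Plaquette 3 L =>
      (∀ m : Fin 3, m < p.2.1.1 → p.1 m = 0) ∧
        (p.1 p.2.1.1 ≠ -1 ∨ ((∀ m : Fin 3, p.2.1.1 < m → m < p.2.1.2 → p.1 m = 0) ∧ p.1 p.2.1.2 ≠ -1))))
    (htM : tM = fun p => if p.1 p.2.1.1 = -1 then (p.1.shift p.2.1.2, p.2.1.1) else (p.1.shift p.2.1.1, p.2.1.2))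
    (hrM : rM = fun p => 4 * ∑ m, (p.1 m).val + (if p.1 p.2.1.1 = -1 then 4 else 3) +
      (if p.1 p.2.1.2 = -1 then 4 else 3))
    (l : List (Edge 3 L)) (hl : l.Nodup) (hall : ∀ e : Edge 3 L, e ∈ l) (U V : GaugeConfig 3 L G) :
    (m / M) ^ ((R - 1) ^ 3) ≤
      imhAcceptQ (fun U : GaugeConfig 3 L G => ∏ p ∈ K, w (plaquetteHolonomy U p.1 p.2.1.1 p.2.1.2))
        (fun U : GaugeConfig 3 L G => (l.map fun b => ∏ p ∈ (BM ∩ K).filter (fun p' => tM p' = b),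
            w (plaquetteHolonomy U p.1 p.2.1.1 p.2.1.2) / (∫ g, w g ∂(haarProbability G))).prod *
          coordAvg (haarProbability G) l.toFinset
            (fun V : GaugeConfig 3 L G => ∏ p ∈ BM ∩ K, w (plaquetteHolonomy V p.1 p.2.1.1 p.2.1.2)) U /
          (∫ V, ∏ p ∈ BM ∩ K, w (plaquetteHolonomy V p.1 p.2.1.1 p.2.1.2)
            ∂(Measure.pi fun _ : Edge 3 L => haarProbability G))) U V := by
  have hL : 2 ≤ L := by omega
  have hval : (K \ BM).card = (R - 1) ^ 3 :=
    (isLeast_card_compl_ranked_box hL hRL K hK BM hBM).unique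
      (isLeast_card_compl_ranked_box_three hR hRL K hK)
  have h := boxMorse_imhAcceptQ_ge (G := G) hL hw hm0 hm hM K BM tM rM hBM htM hrM l hl hall U V
  rwa [hval] at h

/-- **TWO DIMENSIONS, FREE BOUNDARY: acceptance `= 1`** — the Morse structure cut to the box is the whole
box (`BoxRankedMorseCount.isLeast_card_compl_ranked_box_two`), so the exact heat-bath autoregression IS the
box target (`1 ≤ R`, `R + 1 ≤ L`). [ours] -/
theorem boxMorse_imhAcceptQ_eq_one_two {w : G → ℝ} (hw : Continuous w) {m M : ℝ} (hm0 : 0 < m)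
    (hm : ∀ g, m ≤ w g) (hM : ∀ g, w g ≤ M) (hR : 1 ≤ R) (hRL : R + 1 ≤ L) (K BM : Finset (Plaquette 2 L))
    (tM : Plaquette 2 L → Edge 2 L) (rM : Plaquette 2 L → ℕ)
    (hK : K = Finset.univ.filter (fun p : Plaquette 2 L =>
      (∀ m : Fin 2, (p.1 m).val < R) ∧ (p.1 p.2.1.1).val + 1 < R ∧ (p.1 p.2.1.2).val + 1 < R))
    (hBM : BM = Finset.univ.filter (fun p : Plaquette 2 L =>
      (∀ m : Fin 2, m < p.2.1.1 → p.1 m = 0) ∧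
        (p.1 p.2.1.1 ≠ -1 ∨ ((∀ m : Fin 2, p.2.1.1 < m → m < p.2.1.2 → p.1 m = 0) ∧ p.1 p.2.1.2 ≠ -1))))
    (htM : tM = fun p => if p.1 p.2.1.1 = -1 then (p.1.shift p.2.1.2, p.2.1.1) else (p.1.shift p.2.1.1, p.2.1.2))
    (hrM : rM = fun p => 4 * ∑ m, (p.1 m).val + (if p.1 p.2.1.1 = -1 then 4 else 3) +
      (if p.1 p.2.1.2 = -1 then 4 else 3))
    (l : List (Edge 2 L)) (hl : l.Nodup) (hall : ∀ e : Edge 2 L, e ∈ l) (U V : GaugeConfig 2 L G) :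
    imhAcceptQ (fun U : GaugeConfig 2 L G => ∏ p ∈ K, w (plaquetteHolonomy U p.1 p.2.1.1 p.2.1.2))
        (fun U : GaugeConfig 2 L G => (l.map fun b => ∏ p ∈ (BM ∩ K).filter (fun p' => tM p' = b),
            w (plaquetteHolonomy U p.1 p.2.1.1 p.2.1.2) / (∫ g, w g ∂(haarProbability G))).prod *
          coordAvg (haarProbability G) l.toFinset
            (fun V : GaugeConfig 2 L G => ∏ p ∈ BM ∩ K, w (plaquetteHolonomy V p.1 p.2.1.1 p.2.1.2)) U /
          (∫ V, ∏ p ∈ BM ∩ K, w (plaquetteHolonomy V p.1 p.2.1.1 p.2.1.2)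
            ∂(Measure.pi fun _ : Edge 2 L => haarProbability G))) U V = 1 := by
  have hL : 2 ≤ L := by omega
  have hval : (K \ BM).card = 0 :=
    (isLeast_card_compl_ranked_box hL hRL K hK BM hBM).unique
      (isLeast_card_compl_ranked_box_two hR hRL K hK)
  have h := boxMorse_imhAcceptQ_ge (G := G) hL hw hm0 hm hM K BM tM rM hBM htM hrM l hl hall U V
  rw [hval, pow_zero] at h
  exact le_antisymm (min_le_left _ _) h

end Summit.Ventures.LatticeQCDFlow.Theory2.Autoregressive

end
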